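import Literature.AlgebraicGeometry.Hyperkaehler.AutZeroAnalytification
import Literature.Geometry.Hyperkaehler.AutomorphismsLocalSystemCohomology
import Literature.Geometry.Hyperkaehler.AutomorphismsLocalSystemFixedPointsFamily
import Literature.AlgebraicGeometry.Hyperkaehler.GeneralizedKummerTypeCohomologyTransport
import HarnessLib

/-!
# `Aut₀`-equivariant cohomology transport along a CHAIN of families of irreducible symplectic manifolds, with the algebraic ends (PROVED from the Hassett–Tschinkel fact)

Layer `Literature/AlgebraicGeometry/Hyperkaehler`.  Cell `hodge-kum4` (ladder HodgeAV, rung H3), tranche LT-H3,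
director-hodge g7 2026-08-27T06:36:46Z item (4): the THEOREM flavour of the transport input `T₄`.  The
tree records `T₄` unconditionally as the PRINT-SYNTHESIS fact
`HassettTschinkel2013_autZero_cohomologyTransport_kumType` (file `GeneralizedKummerTypeCohomologyTransport`);
this file DERIVES its ∃-body — a homeomorphism `e : X(ℂ) ≃ₜ K(ℂ)` and `θ : Aut₀(K) ≃* Aut₀(X)` with
`e^*(g^* c) = (θ g)^*(e^* c)` — from the single REFEREED fact
`Geometry.Hyperkaehler.HassettTschinkel2013_holAutZero_localSystem` (Thm. 2.1, taken as a hypothesis `h`)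
for every pair of smooth projective `X`, `K` whose analytifications are joined by a chain of proper
holomorphic submersions ALL OF WHOSE FIBRES ARE IRREDUCIBLE SYMPLECTIC (the cell's located «IHS-chain»
hypothesis, cell INBOX 2026-08-26T18:10:22Z (a); the tree's `AreDeformationEquivalent` /
`IsOfGeneralizedKummerType` allow arbitrary compact complex fibres in between, which is exactly why the
unconditional `T₄` stays a print-synthesis fact):

* `HassettTschinkel2013_holAutZero_localSystem.exists_homeomorph_mulEquiv_cohomology_of_chain` — the
  one-family theorem (`Geometry/Hyperkaehler/AutomorphismsLocalSystemCohomology`) propagated along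
  `Relation.EqvGen` of the IHS-family step (equivariant pairs are reflexive, symmetric, transitive);
* `isDeformationEquivalent_of_ihsChain` — such a chain is in particular a deformation equivalence;
* `exists_mulEquiv_autZero_holAutZero` — GAGA end: `Aut₀(X) ≃* Aut°(X^an)` through
  `autEquivHolAutGroup` / `mem_autZero_iff_analyticAut_mem_holAutZero` (file `AutZeroAnalytification`,
  PROVED), with `analyticAut δ = φ⁻¹ ∘ δ(ℂ) ∘ φ`;
* **`HassettTschinkel2013_holAutZero_localSystem.autZero_cohomologyTransport_of_ihsChain`** — for
  smooth projective `X`, `K` of dimension `n` with analytifications `φ : M ≅ X(ℂ)`, `ψ : N ≅ K(ℂ)`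
  joined by an IHS chain: `∃ (e : X(ℂ) ≃ₜ K(ℂ)) (θ : autZero K ≃* autZero X)`,
  `e^*(g^* c) = (θ g)^*(e^* c)` on `Hᵏ(·(ℂ); ℂ)` — literally the ∃-tail of the fact `T₄`;
* `hassettTschinkel2013_autZero_cohomologyTransport_kumType_of_ihsChains` — hence the fact `T₄` itself
  FOLLOWS from the Hassett–Tschinkel fact once every `Kumⁿ`-type `X` is IHS-chained to its `Kⁿ(A)`: the
  IHS-chain hypothesis is the exact and only residual of the synthesis.

Everything is proved; no named fact, no definition, no instance, no notation; nothing here asserts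
HC / HC_Kum4Type / L1, nor `T₄` for all `Kum⁴`-type varieties.

References: B. Hassett, Yu. Tschinkel, Mosc. Math. J. 13 (2013) §2 Thm. 2.1 [`HassettTschinkel2013`];
K. Kodaira (2005) §2.3 [`Kodaira2005`]; C. Voisin (2002) §9.2.1 [`VoisinHodgeI2002`]; K. Oguiso, Nagoya
Math. J. 239 (2020) §4 [`Oguiso2020CohomologicallyTrivialKummer`]; J.-P. Serre, GAGA (1956) §2–§3
[`SerreGAGA1956`].
-/

noncomputable section

open scoped Manifold ContDiff Topology
open CategoryTheory Function Set
open Literature.Geometry.Kaehler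
open Literature.Geometry.Hyperkaehler
open Literature.AlgebraicTopology.SingularHomology
open Literature.NumberTheory.Transcendental
open Literature.AlgebraicGeometry.Motives (SchemeOver ComplexPoints IsSmoothProjective AlgPoints)

universe u v

/-! ### Along a chain of IHS families (analytic; any universe) -/

namespace Literature.Geometry.Hyperkaehler

/-- **Equivariant cohomology transport along a CHAIN of families of irreducible symplectic manifolds**:
if `X` and `Y` are joined by `Relation.EqvGen` of «fibres of one proper holomorphic submersion over a
connected base all of whose fibres are irreducible symplectic», then there are `m : X ≃ₜ Y` and
`θ : Aut°(X) ≃* Aut°(Y)` with `m^* ((θ g)^* c) = g^* (m^* c)` on `Hᵏ(·; R)` (one-family theorem +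
equivariant pairs compose/invert). [cite: HassettTschinkel2013, §2 Thm. 2.1] [cite: Kodaira2005, §2.3 Thm. 2.3 and Def. 2.9] -/
theorem HassettTschinkel2013_holAutZero_localSystem.exists_homeomorph_mulEquiv_cohomology_of_chain
    (h : HassettTschinkel2013_holAutZero_localSystem.{u}) {X Y : ComplexManifold.{u}}
    (hXY : Relation.EqvGen (fun X Y : ComplexManifold.{u} =>
      ∃ (𝒴 C : ComplexManifold.{u}) (ϖ : 𝒴 → C) (s t : C) (ι : X → 𝒴) (κ : Y → 𝒴),
        T2Space 𝒴 ∧ SecondCountableTopology 𝒴 ∧ T2Space C ∧ SecondCountableTopology C ∧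
          ConnectedSpace C ∧ IsProperHolomorphicSubmersion 𝒴.model C.model ϖ ∧
          IsFibreEmbedding X.model 𝒴.model ϖ s ι ∧ IsFibreEmbedding Y.model 𝒴.model ϖ t κ ∧
          ∀ c : C, ∃ (Z : ComplexManifold.{u}) (μ : Z → 𝒴),
            IsFibreEmbedding Z.model 𝒴.model ϖ c μ ∧ Z.IsIrreducibleSymplectic) X Y)
    (R : Type v) [CommRing R] :
    ∃ (m : X ≃ₜ Y) (θ : holAutZero X.model X ≃* holAutZero Y.model Y),
      ∀ (g : holAutZero X.model X) (k : ℕ) (c : singularCohomology R R Y k),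
        singularCohomology.map R R (m : C(X, Y)) k
            (singularCohomology.map R R ((θ g : Y ≃ₜ Y) : C(Y, Y)) k c) =
          singularCohomology.map R R ((g : X ≃ₜ X) : C(X, X)) k
            (singularCohomology.map R R (m : C(X, Y)) k c) := by
  induction hXY with
  | rel X Y hstep => exact h.exists_homeomorph_mulEquiv_cohomology_of_family hstep R
  | refl X => exact ⟨Homeomorph.refl X, MulEquiv.refl _, equivariantPair_refl R⟩
  | symm X Y _ ih =>
    obtain ⟨m, θ, hm⟩ := ih
    exact ⟨m.symm, θ.symm, equivariantPair_symm R m θ hm⟩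
  | trans X Y Z _ _ ih₁ ih₂ =>
    obtain ⟨m, θ, hm⟩ := ih₁
    obtain ⟨m', θ', hm'⟩ := ih₂
    exact ⟨m.trans m', θ.trans θ', equivariantPair_trans R m θ m' θ' hm hm'⟩

/-- An IHS chain is in particular a deformation equivalence (drop the every-fibre-IHS conjunct in each
step; `Relation.EqvGen.mono`). [cite: Kodaira2005, §2.3 Def. 2.9] -/
theorem isDeformationEquivalent_of_ihsChain {X Y : ComplexManifold.{u}}
    (hXY : Relation.EqvGen (fun X Y : ComplexManifold.{u} =>
      ∃ (𝒴 C : ComplexManifold.{u}) (ϖ : 𝒴 → C) (s t : C) (ι : X → 𝒴) (κ : Y → 𝒴),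
        T2Space 𝒴 ∧ SecondCountableTopology 𝒴 ∧ T2Space C ∧ SecondCountableTopology C ∧
          ConnectedSpace C ∧ IsProperHolomorphicSubmersion 𝒴.model C.model ϖ ∧
          IsFibreEmbedding X.model 𝒴.model ϖ s ι ∧ IsFibreEmbedding Y.model 𝒴.model ϖ t κ ∧
          ∀ c : C, ∃ (Z : ComplexManifold.{u}) (μ : Z → 𝒴),
            IsFibreEmbedding Z.model 𝒴.model ϖ c μ ∧ Z.IsIrreducibleSymplectic) X Y) :
    IsDeformationEquivalent X Y := by
  induction hXY with
  | rel X Y hstep => exact (isDeformationOf_of_family_irreducibleSymplectic hstep).isDeformationEquivalent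
  | refl X => exact IsDeformationEquivalent.refl X
  | symm X Y _ ih => exact ih.symm
  | trans X Y Z _ _ ih₁ ih₂ => exact ih₁.trans ih₂

end Literature.Geometry.Hyperkaehler

/-! ### The algebraic ends (universe `0`: complex points of `ℂ`-schemes) -/

namespace Literature.AlgebraicGeometry.Hyperkaehler

variable {n : ℕ} {X : SchemeOver ℂ}
  {E : Type} [NormedAddCommGroup E] [NormedSpace ℂ E] [FiniteDimensional ℂ E]
  {M : Type} [TopologicalSpace M] [ChartedSpace E M] {φ : M → ComplexPoints X}

/-- **GAGA end: `Aut₀(X) ≃* Aut°(X^an)`** — the restriction of `autEquivHolAutGroup : Aut X ≃* Aut(X^an)`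
to the automorphisms acting trivially on `H²` (`mem_autZero_iff_analyticAut_mem_holAutZero`), with
`ψ δ = analyticAut δ = φ⁻¹ ∘ δ(ℂ) ∘ φ`. [cite: SerreGAGA1956, §2 Prop. 2 and §3 n°20] [cite: HassettTschinkel2013, §2 (p. 3)] -/
theorem exists_mulEquiv_autZero_holAutZero [IsManifold 𝓘(ℂ, E) ω M] (hX : IsSmoothProjective n X)
    (hφ : IsAnalytification E X n φ) :
    ∃ ψ : autZero X ≃* holAutZero E M, ∀ δ : autZero X,
      ((ψ δ : holAutZero E M) : M ≃ₜ M) = analyticAut hφ δ.val := by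
  let Φ := autEquivHolAutGroup hX hφ
  let f : autZero X → holAutZero E M := fun δ ↦
    ⟨analyticAut hφ δ.val, (mem_autZero_iff_analyticAut_mem_holAutZero hX hφ δ.val).1 δ.property⟩
  have hΦsymm : ∀ a : holAutGroup E M, analyticAut hφ (Φ.symm a) = (a : M ≃ₜ M) := fun a ↦ by
    rw [← coe_autEquivHolAutGroup hX hφ, MulEquiv.apply_symm_apply]
  let f' : holAutZero E M → autZero X := fun a ↦
    ⟨Φ.symm ⟨a.val, holAutZero_le_holAutGroup a.property⟩,
      (mem_autZero_iff_analyticAut_mem_holAutZero hX hφ _).2 (by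
        rw [hΦsymm]; exact a.property)⟩
  refine ⟨{ toFun := f, invFun := f', left_inv := ?_, right_inv := ?_, map_mul' := ?_ }, fun δ ↦ rfl⟩
  · intro δ
    apply Subtype.ext
    change Φ.symm ⟨analyticAut hφ δ.val, _⟩ = δ.val
    have hΦδ : Φ δ.val = ⟨analyticAut hφ δ.val, analyticAut_mem_holAutGroup hX hφ δ.val⟩ :=
      Subtype.ext (coe_autEquivHolAutGroup hX hφ δ.val)
    rw [← hΦδ, MulEquiv.symm_apply_apply]
  · intro a
    apply Subtype.ext
    change analyticAut hφ (Φ.symm ⟨a.val, _⟩) = a.val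
    exact hΦsymm _
  · intro δ δ'
    apply Subtype.ext
    change analyticAut hφ (δ.val * δ'.val) = analyticAut hφ δ.val * analyticAut hφ δ'.val
    exact map_mul (analyticAut hφ) δ.val δ'.val

/-- `(analyticAut δ)^* (φ^* c) = φ^* (δ^* c)`: the analytification homeomorphism intertwines `δ(ℂ)` with
`analyticAut δ` on cohomology. [cite: SerreGAGA1956, §2 Prop. 2] [cite: Hatcher2002, §3.1] -/
theorem map_analyticAut_map_homeomorph (hφ : IsAnalytification E X n φ) (δ : Aut X) (k : ℕ)
    (c : HodgeTheory.complexBetti X k) :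
    singularCohomology.map ℂ ℂ ((analyticAut hφ δ : M ≃ₜ M) : C(M, M)) k
        (singularCohomology.map ℂ ℂ (hφ.homeomorph : C(M, ComplexPoints X)) k c) =
      singularCohomology.map ℂ ℂ (hφ.homeomorph : C(M, ComplexPoints X)) k
        (HodgeTheory.complexBetti.map δ.hom k c) := by
  rw [singularCohomology_map_analyticAut, ModuleCat.comp_apply, ModuleCat.comp_apply,
    ← ModuleCat.comp_apply _ (singularCohomology.map ℂ ℂ (hφ.homeomorph.symm : C(ComplexPoints X, M)) k),
    singularCohomology_map_homeomorph_comp_symm, ModuleCat.id_apply]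

/-- `(φ⁻¹)^* ((analyticAut δ)^* x) = δ^* ((φ⁻¹)^* x)`. [cite: SerreGAGA1956, §2 Prop. 2] [cite: Hatcher2002, §3.1] -/
theorem map_symm_map_analyticAut (hφ : IsAnalytification E X n φ) (δ : Aut X) (k : ℕ)
    (x : singularCohomology ℂ ℂ M k) :
    singularCohomology.map ℂ ℂ (hφ.homeomorph.symm : C(ComplexPoints X, M)) k
        (singularCohomology.map ℂ ℂ ((analyticAut hφ δ : M ≃ₜ M) : C(M, M)) k x) =
      HodgeTheory.complexBetti.map δ.hom k
        (singularCohomology.map ℂ ℂ (hφ.homeomorph.symm : C(ComplexPoints X, M)) k x) := by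
  rw [singularCohomology_map_analyticAut, ModuleCat.comp_apply, ModuleCat.comp_apply,
    ← ModuleCat.comp_apply _ (singularCohomology.map ℂ ℂ (hφ.homeomorph.symm : C(ComplexPoints X, M)) k),
    singularCohomology_map_homeomorph_comp_symm, ModuleCat.id_apply]

/-- **`T₄`'s ∃-body DERIVED along an IHS chain** (Hassett–Tschinkel Thm. 2.1 as the hypothesis `h` +
Ehresmann + GAGA, all the rest PROVED): for smooth projective `X`, `K` of dimension `n` with
analytifications `φ : M ≅ X(ℂ)`, `ψ : N ≅ K(ℂ)` joined by a chain of proper holomorphic submersions of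
irreducible symplectic manifolds, there are a homeomorphism `e : X(ℂ) ≃ₜ K(ℂ)` and
`θ : Aut₀(K) ≃* Aut₀(X)` with `e^* (g^* c) = (θ g)^* (e^* c)` for all `g ∈ Aut₀(K)`, `k`, `c ∈ Hᵏ(K(ℂ); ℂ)`
— the conclusion of `HassettTschinkel2013_autZero_cohomologyTransport_kumType` for this pair.
[cite: HassettTschinkel2013, §2 Thm. 2.1] [cite: VoisinHodgeI2002, §9.1.1 Thm. 9.3 and §9.2.1]
[cite: Oguiso2020CohomologicallyTrivialKummer, §4 (proof of Thm. 1.3)] [cite: SerreGAGA1956, §2 Prop. 2 and §3 n°20] -/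
theorem HassettTschinkel2013_holAutZero_localSystem.autZero_cohomologyTransport_of_ihsChain
    (h : Literature.Geometry.Hyperkaehler.HassettTschinkel2013_holAutZero_localSystem.{0})
    {K : SchemeOver ℂ} (hX : IsSmoothProjective n X) (hK : IsSmoothProjective n K)
    (hXK : ∃ (M N : ComplexManifold.{0}) (φ : M → ComplexPoints X) (ψ : N → ComplexPoints K),
      IsAnalytification M.model X n φ ∧ IsAnalytification N.model K n ψ ∧
      Relation.EqvGen (fun X Y : ComplexManifold.{0} =>
        ∃ (𝒴 C : ComplexManifold.{0}) (ϖ : 𝒴 → C) (s t : C) (ι : X → 𝒴) (κ : Y → 𝒴),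
          T2Space 𝒴 ∧ SecondCountableTopology 𝒴 ∧ T2Space C ∧ SecondCountableTopology C ∧
            ConnectedSpace C ∧ IsProperHolomorphicSubmersion 𝒴.model C.model ϖ ∧
            IsFibreEmbedding X.model 𝒴.model ϖ s ι ∧ IsFibreEmbedding Y.model 𝒴.model ϖ t κ ∧
            ∀ c : C, ∃ (Z : ComplexManifold.{0}) (μ : Z → 𝒴),
              IsFibreEmbedding Z.model 𝒴.model ϖ c μ ∧ Z.IsIrreducibleSymplectic) M N) :
    ∃ (e : ComplexPoints X ≃ₜ ComplexPoints K) (θ : autZero K ≃* autZero X),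
      ∀ (g : autZero K) (k : ℕ) (c : HodgeTheory.complexBetti K k),
        singularCohomology.map ℂ ℂ (e : C(ComplexPoints X, ComplexPoints K)) k
            (singularCohomology.map ℂ ℂ (AlgPoints.mapContinuous (L := ℂ) g.val.hom) k c) =
          singularCohomology.map ℂ ℂ (AlgPoints.mapContinuous (L := ℂ) (θ g).val.hom) k
            (singularCohomology.map ℂ ℂ (e : C(ComplexPoints X, ComplexPoints K)) k c) := by
  obtain ⟨M, N, φ, ψ, hφ, hψ, hchain⟩ := hXK
  -- the analytic transport `m : M ≃ₜ N`, `θan : Aut°(M) ≃* Aut°(N)`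
  obtain ⟨m, θan, hm⟩ := h.exists_homeomorph_mulEquiv_cohomology_of_chain hchain ℂ
  -- the GAGA ends
  obtain ⟨ψX, hψX⟩ := exists_mulEquiv_autZero_holAutZero hX hφ
  obtain ⟨ψK, hψK⟩ := exists_mulEquiv_autZero_holAutZero hK hψ
  refine ⟨hφ.homeomorph.symm.trans (m.trans hψ.homeomorph), ψK.trans (θan.symm.trans ψX.symm), ?_⟩
  intro g k c
  -- names
  set δX : autZero X := ψX.symm (θan.symm (ψK g)) with hδX
  have hθg : (ψK.trans (θan.symm.trans ψX.symm)) g = δX := rfl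
  have haX : ((θan.symm (ψK g) : holAutZero M.model M) : M ≃ₜ M) = analyticAut hφ δX.val := by
    rw [← hψX δX, hδX, MulEquiv.apply_symm_apply]
  have haK : ((ψK g : holAutZero N.model N) : N ≃ₜ N) = analyticAut hψ g.val := hψK g
  -- `e^*` as a composite of pull-backs
  have he : ((hφ.homeomorph.symm.trans (m.trans hψ.homeomorph) : ComplexPoints X ≃ₜ ComplexPoints K) :
      C(ComplexPoints X, ComplexPoints K)) =
      (hψ.homeomorph : C(N, ComplexPoints K)).comp ((m : C(M, N)).comp
        (hφ.homeomorph.symm : C(ComplexPoints X, M))) := by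
    ext x; rfl
  rw [hθg, he, singularCohomology.map_comp, singularCohomology.map_comp, ModuleCat.comp_apply,
    ModuleCat.comp_apply, ModuleCat.comp_apply, ModuleCat.comp_apply]
  -- `ψ^* g^* = (analyticAut g)^* ψ^*`
  have h1 : singularCohomology.map ℂ ℂ (hψ.homeomorph : C(N, ComplexPoints K)) k
      (singularCohomology.map ℂ ℂ (AlgPoints.mapContinuous (L := ℂ) g.val.hom) k c) =
      singularCohomology.map ℂ ℂ (((ψK g : holAutZero N.model N) : N ≃ₜ N) : C(N, N)) k
        (singularCohomology.map ℂ ℂ (hψ.homeomorph : C(N, ComplexPoints K)) k c) := by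
    rw [haK, map_analyticAut_map_homeomorph]
  -- `m^* (aK^* y) = aX^* (m^* y)` with `aK = θan aX`
  have h2 : ∀ y : singularCohomology ℂ ℂ N k,
      singularCohomology.map ℂ ℂ (m : C(M, N)) k
        (singularCohomology.map ℂ ℂ (((ψK g : holAutZero N.model N) : N ≃ₜ N) : C(N, N)) k y) =
      singularCohomology.map ℂ ℂ (((θan.symm (ψK g) : holAutZero M.model M) : M ≃ₜ M) : C(M, M)) k
        (singularCohomology.map ℂ ℂ (m : C(M, N)) k y) := fun y ↦ by
    have h := hm (θan.symm (ψK g)) k y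
    rw [MulEquiv.apply_symm_apply] at h
    exact h
  -- `(φ⁻¹)^* aX^* = δX^* (φ⁻¹)^*`
  have h3 : ∀ z : singularCohomology ℂ ℂ M k,
      singularCohomology.map ℂ ℂ (hφ.homeomorph.symm : C(ComplexPoints X, M)) k
        (singularCohomology.map ℂ ℂ (((θan.symm (ψK g) : holAutZero M.model M) : M ≃ₜ M) : C(M, M)) k z) =
      singularCohomology.map ℂ ℂ (AlgPoints.mapContinuous (L := ℂ) δX.val.hom) k
        (singularCohomology.map ℂ ℂ (hφ.homeomorph.symm : C(ComplexPoints X, M)) k z) := fun z ↦ by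
    rw [haX, map_symm_map_analyticAut]
  rw [h1, h2, h3]

/-! ### What separates the fact `T₄` from a theorem: the IHS-chain hypothesis, and nothing else -/

/-- **`T₄` from Hassett–Tschinkel + IHS chains.**  If every smooth projective `X` of `Kumⁿ`-type is
joined to (an analytification of) a smooth projective generalized Kummer variety `Kⁿ(A)` of an abelian
surface by a chain of proper holomorphic submersions ALL OF WHOSE FIBRES ARE IRREDUCIBLE SYMPLECTIC (the
printed meaning of "deformation of `Kⁿ(A)`"; the tree's `IsOfGeneralizedKummerType` records a chain with
arbitrary compact complex fibres — the cell's located «IHS-chain» point), then the PRINT-SYNTHESIS fact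
`HassettTschinkel2013_autZero_cohomologyTransport_kumType` (`T₄`) FOLLOWS from the REFEREED fact
`Geometry.Hyperkaehler.HassettTschinkel2013_holAutZero_localSystem` (Thm. 2.1) by the tree's theorems
(`autZero_cohomologyTransport_of_ihsChain`).  This is the exact residual of the synthesis.
[cite: HassettTschinkel2013, §2 Thm. 2.1] [cite: Kodaira2005, §2.3 Def. 2.9] -/
theorem hassettTschinkel2013_autZero_cohomologyTransport_kumType_of_ihsChains
    (h : Literature.Geometry.Hyperkaehler.HassettTschinkel2013_holAutZero_localSystem.{0})
    (hchain : ∀ ⦃n : ℕ⦄ ⦃X : SchemeOver ℂ⦄, IsSmoothProjective (2 * n) X →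
      IsOfGeneralizedKummerType n X →
        ∃ (A : Motives.AbelianVariety ℂ) (K : SchemeOver ℂ), A.dim = 2 ∧
          IsGeneralizedKummerVarietyOf n A K ∧ IsSmoothProjective (2 * n) K ∧
          ∃ (M N : ComplexManifold.{0}) (φ : M → ComplexPoints X) (ψ : N → ComplexPoints K),
            IsAnalytification M.model X (2 * n) φ ∧ IsAnalytification N.model K (2 * n) ψ ∧
            Relation.EqvGen (fun X Y : ComplexManifold.{0} =>
              ∃ (𝒴 C : ComplexManifold.{0}) (ϖ : 𝒴 → C) (s t : C) (ι : X → 𝒴) (κ : Y → 𝒴),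
                T2Space 𝒴 ∧ SecondCountableTopology 𝒴 ∧ T2Space C ∧ SecondCountableTopology C ∧
                  ConnectedSpace C ∧ IsProperHolomorphicSubmersion 𝒴.model C.model ϖ ∧
                  IsFibreEmbedding X.model 𝒴.model ϖ s ι ∧ IsFibreEmbedding Y.model 𝒴.model ϖ t κ ∧
                  ∀ c : C, ∃ (Z : ComplexManifold.{0}) (μ : Z → 𝒴),
                    IsFibreEmbedding Z.model 𝒴.model ϖ c μ ∧ Z.IsIrreducibleSymplectic) M N) :
    HassettTschinkel2013_autZero_cohomologyTransport_kumType := by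
  intro n X hX hKum
  obtain ⟨A, K, hA, hK, hKs, M, N, φ, ψ, hφ, hψ, hMN⟩ := hchain hX hKum
  obtain ⟨e, θ, heθ⟩ :=
    HassettTschinkel2013_holAutZero_localSystem.autZero_cohomologyTransport_of_ihsChain h hX hKs
      ⟨M, N, φ, ψ, hφ, hψ, hMN⟩
  exact ⟨A, K, hA, hK, hKs, e, θ, heθ⟩

end Literature.AlgebraicGeometry.Hyperkaehler

end
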